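import Summits.KontsevichZagierPeriods.KontsevichZagierPeriods.Theses.CommonUnfolding
import Summits.KontsevichZagierPeriods.KontsevichZagierPeriods.Theorems.FurushoPentagonReducedPeriodRingDefs
import Summits.KontsevichZagierPeriods.KontsevichZagierPeriods.Theorems.FurushoPentagonSectorToKernelOfLeaves
import Literature.NumberTheory.Transcendental.AyoubPeriodSeries

/-!
# `UnfoldingComplement` (stmt-KontsevichZagierPeriods-14445, route CommonUnfolding, crux rank 9) — birth skeleton

Crux (the route's conjecture-grade COMPLEMENT, filed by the route-choice repair 2026-08-16):
`UnfoldingComplement := PeakNormalForm → CommonUnfoldingThesis` — GIVEN the single-peak normal form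
(KZ-equivalent ⇒ common unfolding), any two KZ-rational integral representations with the same value
have a common unfolding. Given `PeakNormalForm` it is equivalent to Kontsevich–Zagier's Conjecture 1
(refuters' certificates `item_iff : UnfoldingComplement ↔ (PeakNormalForm → KontsevichZagierPeriods)`,
evidence `Evidence.lean` / `W.lean` on the item), so a skeleton of the complement is a skeleton of
Conjecture 1 read through the normal form. The route header's own foreseen split is followed
("UnfoldingComplement ⇐ AyoubStokesUnfolding (tame-cube sector, Ayoub 2015 Conj. 1.1) →
CubeCompilation (every representation compiles into tame cubes inside the rules)"), in the
KZ-EQUIVALENCE form (weaker than the common-unfolding form, and interchangeable with it under the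
hypothesis `PeakNormalForm`, which is exactly where the normal form is consumed below).

Line (two registered stubs, both SHARED byte-for-byte with the registered skeleton of crux
`FurushoPentagon.SectorToKernel` (stmt-KontsevichZagierPeriods-10813, line `effective-cube-surjection`,
stubs S1 and S6 — the only two of its six stubs not yet landed; S1 is also stub S1b of crux
`FurushoPentagon.ReducedPeriodRing`, stmt-3929), so that ONE proof closes the stub everywhere):

* `stub_cubeResolution` (S1, RESOLUTION / COMPILATION; theorem-grade, transcendence-free, XL —
  Hironaka / rectilinearisation strength): every integral representation is, modulo the KZ relations,
  a `ℤ`-combination of TAME CUBE classes `[[0,1]ⁿ, f]`, `f` real-analytic near the closed cube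
  (`ReducedPeriodRing.cubicalSpan`, landed vocabulary `Theorems/FurushoPentagonReducedPeriodRingDefs.lean`).
  It follows verbatim from the existing item stmt-KontsevichZagierPeriods-3574
  `LiftingCriteria.CubeNashNormalForm` (landed: `SectorToKernel.cubeResolution_of_cubeNashNormalForm`),
  and its bounded-volume residue is `SectorToKernel.cubeResolution_of_boundedVolumes` (Viu-Sos 2021).
* `stub_ayoubEffectiveCubeKernel` (S6, THE LEAF; conjecture-grade = the content of the crux): J. Ayoub,
  Ann. of Math. 181 (2015), Conj. 1.1 at `k = ℚ` over the tree's honest complex vocabulary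
  (`AyoubRel.Oan / intC / relAC / kSpan`, `Literature/NumberTheory/Transcendental/AyoubPeriodSeries.lean`):
  the kernel of `∫_{[0,1]^∞}` on `𝒪_{ℚ-alg}(𝔻̄^∞)` is the `ℚ`-span of the Stokes elements
  `∂G/∂zᵢ − G|_{zᵢ=1} + G|_{zᵢ=0}` (its `⊇` half is the tree theorem `AyoubRel.intC_relAC_eq_zero`).

Composition `UnfoldingComplement_of : S1-sig → S6-sig → UnfoldingComplement` (sorry-free): for
KZ-rational `r`, `r'` with `r.value = r'.value`, the LANDED composition of line `effective-cube-surjection`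
(`SectorToKernel.kontsevichZagierPeriods_of_cubeResolution_of_ayoubKernel`, Theorems file
`FurushoPentagonSectorToKernelOfLeaves.lean`: cube normal form (S1) ⇒ merging into one tame cube
(`stub_cubeMerge`, landed) ⇒ Ayoub-admissible re-summation (S2, landed) ⇒ soundness ⇒ real Stokes form
from the leaf (S3 fed with S6, landed) ⇒ semialgebraicity (S4, landed) ⇒ Stokes-span calibration (S5,
landed) ⇒ kernel form ⇒ two-representation form `kzKernelConjecture_iff_isRational`) gives
`KZ.Equivalent r r'`, and the route's normal form `PeakNormalForm` (the hypothesis of the crux) turns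
this equivalence into the common unfolding demanded by `CommonUnfoldingThesis`. The normal form is
load-bearing (it is the only producer of peaks); the two stubs are transcendence-input (S6) and
rules-side compilation (S1), neither of which mentions unfoldings.

Disproof used: none on file — `Cruxes/UnfoldingComplement/` had no workfiles before this one (no
`Disproof.lean`, no dead lines); `ledger negatives --problem KontsevichZagierPeriods` has one unrelated
entry (KinematicFormulas, plane convexity). All statements are over existing declarations only.
-/

noncomputable section

set_option linter.dupNamespace false

namespace Summit.KontsevichZagierPeriods.KontsevichZagierPeriods.Cruxes.UnfoldingComplement.Birth

open Set MeasureTheory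
open Literature.NumberTheory.Transcendental
open Literature.NumberTheory.Transcendental.KZ hiding cubicalSpan
open Summit.KontsevichZagierPeriods.KontsevichZagierPeriods.Theses.CommonUnfolding
  (PeakNormalForm CommonUnfoldingThesis UnfoldingComplement)
open Summit.KontsevichZagierPeriods.FurushoPentagon.ReducedPeriodRing (unitCube cubicalGens cubicalSpan)
open Summit.KontsevichZagierPeriods.FurushoPentagon.SectorToKernel
  (kontsevichZagierPeriods_of_cubeResolution_of_ayoubKernel)

/-! ## The two registered stubs -/

/-- **S1 (resolution / compilation; shared with crux 10813 S1 and crux 3929 S1b).** Every integral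
representation is, modulo the KZ relations, a `ℤ`-combination of tame cube classes.
Theorem-grade (XL): cubical resolution of the boundary singularities and of the unbounded ends of a
`ℚ`-semialgebraic absolutely convergent integrand, inside rules (1)–(3).
[Ayoub 2014, Rem. 12; Viu-Sos 2021, Thm. 1.1; Huber–Müller-Stach 2017, §12.2] -/
theorem stub_cubeResolution :
    ∀ (N : ℕ) (u : IntegralRep N), ∃ c : FormalRep, c ∈ cubicalSpan ∧ of u - c ∈ relations := by
  sorry

/-- **S6 — the leaf: Ayoub's effective cube conjecture over `k = ℚ` (shared with crux 10813 S6).**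
The kernel of `∫_{[0,1]^∞}` on `𝒪_{ℚ-alg}(𝔻̄^∞)` is the `ℚ`-span of the Stokes elements
`∂G/∂zᵢ − G|_{zᵢ=1} + G|_{zᵢ=0}`. OPEN (period-conjecture strength; this is where the crux's
conjecture-grade content lives). [Ayoub, Ann. of Math. 181 (2015), Conj. 1.1] -/
theorem stub_ayoubEffectiveCubeKernel :
    ∀ F ∈ AyoubRel.Oan (Rat.castHom ℂ), AyoubRel.intC F = 0 → F ∈ AyoubRel.kSpan (Rat.castHom ℂ) {x : AyoubRel.CSeries | ∃ G ∈ AyoubRel.Oan (Rat.castHom ℂ), ∃ i : ℕ, x = AyoubRel.relAC i G} := by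
  sorry

/-! ## Glue (sorry-free) -/

/-- **KZ-equivalence of equal rational representations from the two stubs**: S1 and S6 give the
two-representation form of Conjecture 1 through the landed composition of line
`effective-cube-surjection` (`kontsevichZagierPeriods_of_cubeResolution_of_ayoubKernel`).
[Ayoub 2015, Conj. 1.1; Kontsevich–Zagier 2001, §1.2] -/
theorem equivalent_of_stubs
    (h1 : ∀ (N : ℕ) (u : IntegralRep N), ∃ c : FormalRep, c ∈ cubicalSpan ∧ of u - c ∈ relations)
    (h6 : ∀ F ∈ AyoubRel.Oan (Rat.castHom ℂ), AyoubRel.intC F = 0 →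
      F ∈ AyoubRel.kSpan (Rat.castHom ℂ)
        {x : AyoubRel.CSeries | ∃ G ∈ AyoubRel.Oan (Rat.castHom ℂ), ∃ i : ℕ, x = AyoubRel.relAC i G})
    {n m : ℕ} (r : IntegralRep n) (r' : IntegralRep m) (hr : r.IsRational) (hr' : r'.IsRational)
    (hv : r.value = r'.value) : Equivalent r r' :=
  (KontsevichZagierPeriods_iff.mp (kontsevichZagierPeriods_of_cubeResolution_of_ayoubKernel h1 h6))
    r r' hr hr' hv

/-! ## The crux -/

/-- **Skeleton theorem** (concludes the crux BY NAME): `UnfoldingComplement` from the two declared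
stubs, written out as hypotheses. Given the normal form `hP : PeakNormalForm` (the crux's own
hypothesis) and KZ-rational `r`, `r'` with equal values, the stubs make `r`, `r'` KZ-equivalent
(`equivalent_of_stubs`) and the normal form converts that equivalence into a common unfolding — a peak
`R` with two round-chains ending level-equivalent to `[r]` and `[r']`.
[Kontsevich–Zagier 2001, §1.2 Conj. 1; Ayoub 2015, Conj. 1.1] -/
theorem UnfoldingComplement_of :
    (∀ (N : ℕ) (u : IntegralRep N), ∃ c : FormalRep, c ∈ cubicalSpan ∧ of u - c ∈ relations) →
    (∀ F ∈ AyoubRel.Oan (Rat.castHom ℂ), AyoubRel.intC F = 0 → F ∈ AyoubRel.kSpan (Rat.castHom ℂ) {x : AyoubRel.CSeries | ∃ G ∈ AyoubRel.Oan (Rat.castHom ℂ), ∃ i : ℕ, x = AyoubRel.relAC i G}) →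
    UnfoldingComplement := by
  intro h1 h6 hP n m r r' hr hr' hv
  -- the two stubs: `r ∼ r'` in the fixed calculus
  have he : Equivalent r r' := equivalent_of_stubs h1 h6 r r' hr hr' hv
  -- the normal form: KZ-equivalent representations have a common unfolding
  exact hP r r' he

/-- The skeleton fed by the two stubs by name (depends on their `sorry`s; not part of the audit of
`UnfoldingComplement_of`). -/
theorem UnfoldingComplement_of_stubs : UnfoldingComplement :=
  UnfoldingComplement_of stub_cubeResolution stub_ayoubEffectiveCubeKernel

end Summit.KontsevichZagierPeriods.KontsevichZagierPeriods.Cruxes.UnfoldingComplement.Birth
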